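import Literature.NumberTheory.EllipticCurves.TwoDescentHalvingGalois
import Literature.NumberTheory.EllipticCurves.TwoDescentRankBounds
import Literature.NumberTheory.EllipticCurves.KummerMap
import Literature.NumberTheory.GaloisRepresentations.GaloisCohomologyKummerProofs
import HarnessLib

/-!
# The character `χ₁ : E[2] → μ₂` of a rational `2`-torsion point and `H¹(χ₁) : H¹(K, E[2]) → H¹(K, μ₂)`

For an elliptic curve `E/K` (`char K = 0`) with rational `2`-torsion `T₁, T₂, T₃` (abscissae
`e₁, e₂, e₃`; tree `WeierstrassCurve.Affine.SplitTwoTorsion`), Silverman's complete `2`-descent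
(AEC Thm. X.1.1 / Prop. X.1.4) reads the connecting homomorphism `κ : E(K) → H¹(K, E[2])` through the
Weil pairing with `Tᵢ`, `E[2] → μ₂`, and Kummer theory `H¹(K, μ₂) ≃ Kˣ/Kˣ²`. This file builds the
cohomological half of that reading, on the tree's geometric points `E(K̄) = geomPoints W`
(`GaloisAction.lean`) and Galois module `μ₂ = DiscreteGaloisModule.mu K 2` (`GaloisCohomology.lean`):

* `geomTwoTorsion h` — `T₁` as a point of `E(K̄)`, fixed by `Γ_K`; `E[2] = {O, T₁, T₂, T₃}` in `E(K̄)`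
  (`eq_zero_or_eq_geomTwoTorsion_of_mem`, from `TwoDescentRankBounds.lean`) and its addition table
  (`geomTwoTorsion_add_swap`, `geomTwoTorsion_add_self`, from `TwoDescentHalvingGalois.lean`);
* `twoTorsionChar h : E[2] →+ μ₂` — the character `χ₁ = e₂(·, T₁)`: `1` on `{O, T₁}`, `-1` on
  `{T₂, T₃}` (values in `MuCarrier K 2 = Additive μ₂(K̄)`), additive by the addition table and
  `Γ_K`-equivariant since both actions are trivial (`mu_two_apply_eq`: `Γ_K` fixes `±1`);
* `twoTorsionCharHom h` — `χ₁` as a morphism of Mathlib's `TopRep ℤ Γ_K`, and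
  `twoTorsionCharH1 h : H¹(K, E[2]) →+ H¹(K, μ₂)` the induced map on continuous cohomology
  (`ContinuousCohomology.map` along `id`), computed on explicit cocycles
  (`twoTorsionCharH1_oneCocycleClass`: `[φ] ↦ [χ₁ ∘ φ]`);
* **injectivity** `eq_zero_of_twoTorsionCharH1_eq_zero`: `(H¹(χ₁), H¹(χ₂))` (`χ₂` = the character of
  `T₂`, i.e. `twoTorsionChar h.swap₁₂`) is injective on `H¹(K, E[2])` — a class killed by both has a
  cocycle `φ` with `χᵢ ∘ φ` a coboundary in `μ₂`, hence `0` (trivial action), so `φ = 0` as `(χ₁, χ₂)`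
  separates `E[2]` (`eq_zero_of_twoTorsionChar_eq_zero`). With the sequel
  `TwoDescentKummerBridge.lean` (`kummerEquiv ∘ H¹(χ₁) ∘ κ = twoDescentComponent`) this is Silverman's
  injection `E(K)/2E(K) ↪ Kˣ/Kˣ² × Kˣ/Kˣ²` lifted to all of `H¹(K, E[2])`.

Definitions with bodies and theorems only; no named fact. Cell `bsd-monsky` (towards the `2`-Selmer
input `#Sel⁽²⁾(E_{2pq}) ≤ 8` of the enclosure of C-P2-1 as a kernel theorem).

## References

* [SilvermanAEC2009] J. H. Silverman, *The Arithmetic of Elliptic Curves*, 2nd ed., GTM 106,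
  Springer 2009, Thm. X.1.1, Prop. X.1.4, Cor. III.6.4, III.§8 (the Weil pairing).
* [SerreGaloisCohomology1997] J.-P. Serre, *Galois Cohomology*, Springer 1997, I.§2.2–2.4, II.§1.2.
-/

noncomputable section

open scoped Classical

universe u



namespace WeierstrassCurve

open Literature.NumberTheory.GaloisRepresentations Literature.NumberTheory.EllipticCurves Field
open WeierstrassCurve.Affine

variable {K : Type u} [Field K] [CharZero K] (W : WeierstrassCurve K) [W.IsElliptic] {e₁ e₂ e₃ : K}

omit [CharZero K] in
/-- The base change of an elliptic curve to a field extension is elliptic (`Δ ↦ ι Δ`, a unit).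
[cite: SilvermanAEC2009, III.§1] -/
theorem isElliptic_baseChange (L : Type*) [Field L] [Algebra K L] : (W.baseChange L).IsElliptic :=
  inferInstanceAs ((W.map (algebraMap K L)).IsElliptic)

/-! ### The rational `2`-torsion points as geometric points -/

/-- The `2`-torsion point `T₁ = (e₁, -(a₁e₁ + a₃)/2)` is a nonsingular point of `E/K̄`.
[cite: SilvermanAEC2009, Prop. X.1.4] -/
theorem nonsingular_geomTwoTorsion (h : W.toAffine.SplitTwoTorsion e₁ e₂ e₃) :
    (W.baseChange (AlgebraicClosure K)).toAffine.Nonsingular (algebraMap K (AlgebraicClosure K) e₁)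
      ((W.baseChange (AlgebraicClosure K)).toAffine.twoTorsionY
        (algebraMap K (AlgebraicClosure K) e₁)) := by
  haveI := W.isElliptic_baseChange (AlgebraicClosure K)
  exact nonsingular_twoTorsion (h.map (AlgebraicClosure K))

/-- The `2`-torsion point `T₁ = (e₁, -(a₁e₁ + a₃)/2)` of `E` with rational `2`-torsion
`e₁, e₂, e₃`, as a point of `E(K̄)` (the other two are `geomTwoTorsion h.swap₁₂`,
`geomTwoTorsion h.swap₂₃.swap₁₂`). [cite: SilvermanAEC2009, Prop. X.1.4] -/
def geomTwoTorsion (h : W.toAffine.SplitTwoTorsion e₁ e₂ e₃) : geomPoints W :=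
  Affine.Point.some _ _ (W.nonsingular_geomTwoTorsion h)

/-- `T₁ ∈ E[2]`. [cite: SilvermanAEC2009, Prop. X.1.4] -/
theorem geomTwoTorsion_mem (h : W.toAffine.SplitTwoTorsion e₁ e₂ e₃) :
    W.geomTwoTorsion h ∈ geomTorsion W 2 := by
  haveI := W.isElliptic_baseChange (AlgebraicClosure K)
  rw [mem_geomTorsion_iff]
  exact Affine.Point.two_zsmul_twoTorsion (h.map (AlgebraicClosure K))

/-- `T₁ ≠ O` (an affine point). [cite: SilvermanAEC2009, Prop. X.1.4] -/
theorem geomTwoTorsion_ne_zero (h : W.toAffine.SplitTwoTorsion e₁ e₂ e₃) :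
    W.geomTwoTorsion h ≠ 0 :=
  Affine.Point.some_ne_zero _

/-- `T₁ ≠ T₂` (the abscissae `e₁ ≠ e₂`). [cite: SilvermanAEC2009, Prop. X.1.4] -/
theorem geomTwoTorsion_ne_swap (h : W.toAffine.SplitTwoTorsion e₁ e₂ e₃) :
    W.geomTwoTorsion h ≠ W.geomTwoTorsion h.swap₁₂ := by
  intro heq
  obtain ⟨hx, -⟩ := Affine.Point.some.inj heq
  exact h.ne₁₂ ((algebraMap K (AlgebraicClosure K)).injective hx)

/-- `Γ_K` fixes `T₁` (its coordinates lie in `K`: the `2`-torsion is rational).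
[cite: SilvermanAEC2009, Prop. X.1.4] -/
theorem smul_geomTwoTorsion (h : W.toAffine.SplitTwoTorsion e₁ e₂ e₃) (σ : absoluteGaloisGroup K) :
    σ • W.geomTwoTorsion h = W.geomTwoTorsion h := by
  set τ : AlgebraicClosure K ≃ₐ[K] AlgebraicClosure K := σ
  show Affine.Point.map (W' := W) (τ : AlgebraicClosure K →ₐ[K] AlgebraicClosure K)
    (W.geomTwoTorsion h) = W.geomTwoTorsion h
  unfold geomTwoTorsion
  rw [Affine.Point.map_some]
  simp only [Affine.Point.some.injEq, AlgEquiv.coe_toAlgHom]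
  refine ⟨τ.commutes e₁, ?_⟩
  simp only [twoTorsionY, baseChange, map_a₁, map_a₃, map_neg, map_div₀, map_add, map_mul,
    map_ofNat, AlgEquiv.commutes]


/-- Two of the points `geomTwoTorsion` coincide iff their abscissae do.
[cite: SilvermanAEC2009, Prop. X.1.4] -/
theorem geomTwoTorsion_eq_iff (h : W.toAffine.SplitTwoTorsion e₁ e₂ e₃) {e₁' e₂' e₃' : K}
    (h' : W.toAffine.SplitTwoTorsion e₁' e₂' e₃') :
    W.geomTwoTorsion h = W.geomTwoTorsion h' ↔ e₁ = e₁' := by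
  constructor
  · intro heq
    obtain ⟨hx, -⟩ := Affine.Point.some.inj heq
    exact (algebraMap K (AlgebraicClosure K)).injective hx
  · rintro rfl
    rfl

/-! ### The addition table of `E[2] = {O, T₁, T₂, T₃}` in `E(K̄)` -/

/-- `T₁ + T₂ = T₃` in `E(K̄)`. [cite: SilvermanAEC2009, Prop. X.1.4] -/
theorem geomTwoTorsion_add_swap (h : W.toAffine.SplitTwoTorsion e₁ e₂ e₃) :
    W.geomTwoTorsion h + W.geomTwoTorsion h.swap₁₂ = W.geomTwoTorsion h.swap₂₃.swap₁₂ := by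
  haveI := W.isElliptic_baseChange (AlgebraicClosure K)
  exact Affine.Point.twoTorsion_add_twoTorsion (h.map (AlgebraicClosure K))

/-- `T₁ + T₁ = O` in `E(K̄)`. [cite: SilvermanAEC2009, Prop. X.1.4] -/
theorem geomTwoTorsion_add_self (h : W.toAffine.SplitTwoTorsion e₁ e₂ e₃) :
    W.geomTwoTorsion h + W.geomTwoTorsion h = 0 := by
  haveI := W.isElliptic_baseChange (AlgebraicClosure K)
  exact Affine.Point.twoTorsion_add_self (h.map (AlgebraicClosure K))

/-- **`E[2] = {O, T₁, T₂, T₃}`** in `E(K̄)` for a curve with rational `2`-torsion.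
[cite: SilvermanAEC2009, Prop. X.1.4, Cor. III.6.4] -/
theorem eq_zero_or_eq_geomTwoTorsion_of_mem (h : W.toAffine.SplitTwoTorsion e₁ e₂ e₃)
    {T : geomPoints W} (hT : T ∈ geomTorsion W 2) :
    T = 0 ∨ T = W.geomTwoTorsion h ∨ T = W.geomTwoTorsion h.swap₁₂ ∨
      T = W.geomTwoTorsion h.swap₂₃.swap₁₂ := by
  haveI := W.isElliptic_baseChange (AlgebraicClosure K)
  rw [mem_geomTorsion_iff] at hT
  have hT' : (2 : ℕ) • T = 0 := by rw [two_nsmul, ← two_zsmul]; exact hT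
  exact Affine.Point.eq_zero_or_eq_twoTorsion_of_two_nsmul_eq_zero (h.map (AlgebraicClosure K)) hT'

/-! ### The character `χ₁ : E[2] → μ₂` attached to `T₁` -/

/-- The quadratic character of `E[2]` attached to the rational `2`-torsion point `T₁`:
`χ₁(O) = χ₁(T₁) = 1`, `χ₁(T₂) = χ₁(T₃) = -1` (the Weil pairing `e₂(·, T₁)`), as a map into the
carrier of the Galois module `μ₂ = μ₂(K̄)`. [cite: SilvermanAEC2009, Thm. X.1.1, Prop. X.1.4] -/
def twoTorsionCharFun (h : W.toAffine.SplitTwoTorsion e₁ e₂ e₃) (T : geomTorsion W 2) :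
    DiscreteGaloisModule.MuCarrier K 2 :=
  DiscreteGaloisModule.MuCarrier.ofRootsOfUnity
    ⟨if (T : geomPoints W) = 0 ∨ (T : geomPoints W) = W.geomTwoTorsion h then 1 else -1, by
      split_ifs <;> simp [mem_rootsOfUnity]⟩

/-- The value of `χ₁` as a unit of `K̄`: `1` on `{O, T₁}`, `-1` otherwise.
[cite: SilvermanAEC2009, Thm. X.1.1] -/
theorem muVal_twoTorsionCharFun (h : W.toAffine.SplitTwoTorsion e₁ e₂ e₃) (T : geomTorsion W 2) :
    muVal K 2 (W.twoTorsionCharFun h T) =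
      if (T : geomPoints W) = 0 ∨ (T : geomPoints W) = W.geomTwoTorsion h then 1 else -1 :=
  rfl

/-- `χ₁` is additive (`E[2] = {O, T₁, T₂, T₃}` with its addition table). [cite: SilvermanAEC2009, Thm. X.1.1] -/
theorem twoTorsionCharFun_add (h : W.toAffine.SplitTwoTorsion e₁ e₂ e₃) (T T' : geomTorsion W 2) :
    W.twoTorsionCharFun h (T + T') = W.twoTorsionCharFun h T + W.twoTorsionCharFun h T' := by
  apply muVal_injective K 2
  rw [muVal_add, muVal_twoTorsionCharFun, muVal_twoTorsionCharFun, muVal_twoTorsionCharFun,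
    AddSubgroup.coe_add]
  have h12 : W.geomTwoTorsion h ≠ W.geomTwoTorsion h.swap₁₂ :=
    fun heq => h.ne₁₂ ((W.geomTwoTorsion_eq_iff h h.swap₁₂).mp heq)
  have h13 : W.geomTwoTorsion h ≠ W.geomTwoTorsion h.swap₂₃.swap₁₂ :=
    fun heq => h.ne₁₃ ((W.geomTwoTorsion_eq_iff h h.swap₂₃.swap₁₂).mp heq)
  have h10 := W.geomTwoTorsion_ne_zero h
  have h20 := W.geomTwoTorsion_ne_zero h.swap₁₂
  have h30 := W.geomTwoTorsion_ne_zero h.swap₂₃.swap₁₂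
  have t12 := W.geomTwoTorsion_add_swap h
  have t21 : W.geomTwoTorsion h.swap₁₂ + W.geomTwoTorsion h =
      W.geomTwoTorsion h.swap₂₃.swap₁₂ := W.geomTwoTorsion_add_swap h.swap₁₂
  have t13 : W.geomTwoTorsion h + W.geomTwoTorsion h.swap₂₃.swap₁₂ =
      W.geomTwoTorsion h.swap₁₂ := W.geomTwoTorsion_add_swap h.swap₂₃
  have t31 : W.geomTwoTorsion h.swap₂₃.swap₁₂ + W.geomTwoTorsion h =
      W.geomTwoTorsion h.swap₁₂ := W.geomTwoTorsion_add_swap h.swap₂₃.swap₁₂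
  have t23 : W.geomTwoTorsion h.swap₁₂ + W.geomTwoTorsion h.swap₂₃.swap₁₂ =
      W.geomTwoTorsion h := W.geomTwoTorsion_add_swap h.swap₁₂.swap₂₃
  have t32 : W.geomTwoTorsion h.swap₂₃.swap₁₂ + W.geomTwoTorsion h.swap₁₂ =
      W.geomTwoTorsion h := W.geomTwoTorsion_add_swap h.swap₁₂.swap₂₃.swap₁₂
  have t11 := W.geomTwoTorsion_add_self h
  have t22 := W.geomTwoTorsion_add_self h.swap₁₂
  have t33 := W.geomTwoTorsion_add_self h.swap₂₃.swap₁₂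
  rcases W.eq_zero_or_eq_geomTwoTorsion_of_mem h T.2 with hT | hT | hT | hT <;>
    rcases W.eq_zero_or_eq_geomTwoTorsion_of_mem h T'.2 with hT' | hT' | hT' | hT' <;>
    simp [hT, hT', t12, t21, t13, t31, t23, t32, t11, t22, t33, h12.symm, h13.symm, h10, h20, h30]


/-- **The character `χ₁ : E[2] →+ μ₂`** (additive form, values in `MuCarrier K 2 = Additive μ₂(K̄)`).
[cite: SilvermanAEC2009, Thm. X.1.1, Prop. X.1.4] -/
def twoTorsionChar (h : W.toAffine.SplitTwoTorsion e₁ e₂ e₃) :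
    geomTorsion W 2 →+ DiscreteGaloisModule.MuCarrier K 2 :=
  AddMonoidHom.mk' (W.twoTorsionCharFun h) (W.twoTorsionCharFun_add h)

/-- Unfolding `twoTorsionChar`. [cite: SilvermanAEC2009, Thm. X.1.1] -/
theorem twoTorsionChar_apply (h : W.toAffine.SplitTwoTorsion e₁ e₂ e₃) (T : geomTorsion W 2) :
    W.twoTorsionChar h T = W.twoTorsionCharFun h T :=
  rfl

omit [CharZero K] [W.IsElliptic] in
/-- `Γ_K` acts trivially on `μ₂ = {±1}`. [cite: Serre1997, Ch. II §1.2] -/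
theorem mu_two_apply_eq (σ : absoluteGaloisGroup K) (v : DiscreteGaloisModule.MuCarrier K 2) :
    DiscreteGaloisModule.mu K 2 σ v = v := by
  apply muVal_injective K 2
  rw [muVal_apply]
  apply Units.ext
  rw [Units.coe_smul]
  have hv : ((muVal K 2 v : (AlgebraicClosure K)ˣ) : AlgebraicClosure K) *
      (muVal K 2 v : AlgebraicClosure K) = 1 := by
    have := congrArg Units.val (muVal_pow_eq_one K 2 v)
    simpa [pow_two] using this
  rcases mul_self_eq_one_iff.mp hv with h1 | h1
  · rw [h1]; exact smul_one σ
  · rw [h1]; simp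

/-- **`χ₁` is `Γ_K`-equivariant**: `χ₁(σ • T) = σ • χ₁(T)` (both sides are trivial actions: `Γ_K`
fixes the rational `2`-torsion points and `±1`). [cite: SilvermanAEC2009, Thm. X.1.1] -/
theorem twoTorsionChar_smul (h : W.toAffine.SplitTwoTorsion e₁ e₂ e₃) (σ : absoluteGaloisGroup K)
    (T : geomTorsion W 2) :
    W.twoTorsionChar h (σ • T) = DiscreteGaloisModule.mu K 2 σ (W.twoTorsionChar h T) := by
  rw [mu_two_apply_eq, twoTorsionChar_apply, twoTorsionChar_apply]
  apply muVal_injective K 2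
  rw [muVal_twoTorsionCharFun, muVal_twoTorsionCharFun,
    Literature.NumberTheory.EllipticCurves.AddSubgroup.torsionBy.coe_smul]
  rcases W.eq_zero_or_eq_geomTwoTorsion_of_mem h T.2 with hT | hT | hT | hT <;>
    simp [hT, smul_geomTwoTorsion]


/-! ### The induced map `H¹(χ₁) : H¹(K, E[2]) → H¹(K, μ₂)` -/

/-- The `Γ_K`-equivariant map `χ₁ : E[2] → μ₂` as a morphism in Mathlib's category `TopRep ℤ Γ_K`
(source `E[2]` with its discrete topology, target the Galois module `μ₂` of
`GaloisCohomology.lean`), in the shape consumed by `ContinuousCohomology.map` along `id : Γ_K → Γ_K`.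
[cite: SerreGaloisCohomology1997, I.§2.4] -/
def twoTorsionCharHom (h : W.toAffine.SplitTwoTorsion e₁ e₂ e₃) :
    TopRep.res ((ContinuousMonoidHom.id (absoluteGaloisGroup K)) :
        absoluteGaloisGroup K →* absoluteGaloisGroup K)
        (discreteTopRep (absoluteGaloisGroup K) (geomTorsion W 2)) ⟶
      (DiscreteGaloisModule.mu K 2).toTopRep :=
  TopRep.ofHom
    { toLinearMap := (W.twoTorsionChar h).toIntLinearMap
      cont := continuous_of_discreteTopology
      isIntertwining' := fun σ ↦ by
        ext T
        exact W.twoTorsionChar_smul h σ T }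

/-- Values of the morphism `twoTorsionCharHom`. [cite: SerreGaloisCohomology1997, I.§2.4] -/
@[simp]
theorem twoTorsionCharHom_hom_apply (h : W.toAffine.SplitTwoTorsion e₁ e₂ e₃)
    (T : geomTorsion W 2) : (W.twoTorsionCharHom h).hom T = W.twoTorsionChar h T :=
  rfl

/-- **`H¹(χ₁) : H¹(K, E[2]) →+ H¹(K, μ₂)`**, the map on continuous cohomology induced by the
`Γ_K`-equivariant character `χ₁ : E[2] → μ₂` (Mathlib's `ContinuousCohomology.map` along the identity
of `Γ_K`); composed with Kummer theory `H¹(K, μ₂) ≃ Kˣ/Kˣ²` it is the `T₁`-component of Silverman's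
`2`-descent map (`twoTorsionCharH1_kummerMapTorsion`). [cite: SilvermanAEC2009, Thm. X.1.1] -/
def twoTorsionCharH1 (h : W.toAffine.SplitTwoTorsion e₁ e₂ e₃) :
    galH1Torsion W 2 →+ H1Mu K 2 :=
  (ContinuousCohomology.map (ContinuousMonoidHom.id (absoluteGaloisGroup K))
    (W.twoTorsionCharHom h) 1).hom.toLinearMap.toAddMonoidHom

/-- **`H¹(χ₁)` on explicit cocycles**: the class of `φ : Γ_K → E[2]` goes to the class of `χ₁ ∘ φ`.
[cite: SerreGaloisCohomology1997, I.§2.4] -/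
theorem twoTorsionCharH1_oneCocycleClass (h : W.toAffine.SplitTwoTorsion e₁ e₂ e₃)
    (φ : contOneCocycles (discreteTopRep (absoluteGaloisGroup K) (geomTorsion W 2))) :
    W.twoTorsionCharH1 h (oneCocycleClass _ φ) =
      oneCocycleClass _ (contOneCocycles.pullback (ContinuousMonoidHom.id (absoluteGaloisGroup K))
        (W.twoTorsionCharHom h) φ) := by
  unfold twoTorsionCharH1
  simp only [LinearMap.toAddMonoidHom_coe, ContinuousLinearMap.coe_coe]
  exact map_oneCocycleClass _ (ContinuousMonoidHom.id (absoluteGaloisGroup K)) (W.twoTorsionCharHom h) φ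


/-! ### `(H¹(χ₁), H¹(χ₂))` is injective: `H¹(K, E[2]) ↪ H¹(K, μ₂) × H¹(K, μ₂)` -/

/-- **`(χ₁, χ₂)` separates `E[2]`**: a `2`-torsion point killed by both characters is `O`
(`χ₁ = 1` on `{O, T₁}`, `χ₂ = 1` on `{O, T₂}`). [cite: SilvermanAEC2009, Thm. X.1.1] -/
theorem eq_zero_of_twoTorsionChar_eq_zero (h : W.toAffine.SplitTwoTorsion e₁ e₂ e₃)
    (T : geomTorsion W 2) (h₁ : W.twoTorsionChar h T = 0) (h₂ : W.twoTorsionChar h.swap₁₂ T = 0) :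
    T = 0 := by
  have hv₁ := congrArg (fun v => ((muVal K 2 v : (AlgebraicClosure K)ˣ) : AlgebraicClosure K)) h₁
  have hv₂ := congrArg (fun v => ((muVal K 2 v : (AlgebraicClosure K)ˣ) : AlgebraicClosure K)) h₂
  simp only [twoTorsionChar_apply, muVal_twoTorsionCharFun, muVal_zero, Units.val_one] at hv₁ hv₂
  have h12 : W.geomTwoTorsion h ≠ W.geomTwoTorsion h.swap₁₂ :=
    fun heq => h.ne₁₂ ((W.geomTwoTorsion_eq_iff h h.swap₁₂).mp heq)
  have h10 := W.geomTwoTorsion_ne_zero h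
  have h20 := W.geomTwoTorsion_ne_zero h.swap₁₂
  have hne : (-1 : AlgebraicClosure K) ≠ 1 := by
    intro h1
    have : (2 : AlgebraicClosure K) = 0 := by linear_combination -h1
    exact two_ne_zero this
  apply Subtype.ext
  rcases W.eq_zero_or_eq_geomTwoTorsion_of_mem h T.2 with hT | hT | hT | hT
  · exact hT
  · rw [hT] at hv₂
    simp only [h10, h12, or_self, if_false, Units.val_neg, Units.val_one] at hv₂
    exact absurd hv₂ hne
  · rw [hT] at hv₁
    simp only [h20, h12.symm, or_self, if_false, Units.val_neg, Units.val_one] at hv₁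
    exact absurd hv₁ hne
  · rw [hT] at hv₁
    have h31 : W.geomTwoTorsion h.swap₂₃.swap₁₂ ≠ W.geomTwoTorsion h :=
      fun heq => h.ne₁₃ ((W.geomTwoTorsion_eq_iff h.swap₂₃.swap₁₂ h).mp heq).symm
    have h30 := W.geomTwoTorsion_ne_zero h.swap₂₃.swap₁₂
    simp only [h30, h31, or_self, if_false, Units.val_neg, Units.val_one] at hv₁
    exact absurd hv₁ hne

/-- **`(H¹(χ₁), H¹(χ₂)) : H¹(K, E[2]) → H¹(K, μ₂)²` is injective**: a class killed by both maps is
zero — its cocycle `φ` has `χᵢ ∘ φ` cohomologous to `0`, hence `= 0` since `Γ_K` acts trivially on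
`μ₂` (coboundaries vanish), so `φ = 0` as `(χ₁, χ₂)` separates `E[2]`. With
`kummerEquiv_twoTorsionCharH1_kummerMapTorsion` this is the injectivity of Silverman's complete
`2`-descent map `E(K)/2E(K) ↪ Kˣ/Kˣ² × Kˣ/Kˣ²` at the level of `H¹(K, E[2])`.
[cite: SilvermanAEC2009, Thm. X.1.1, Prop. X.1.4] -/
theorem eq_zero_of_twoTorsionCharH1_eq_zero (h : W.toAffine.SplitTwoTorsion e₁ e₂ e₃)
    (c : galH1Torsion W 2) (h₁ : W.twoTorsionCharH1 h c = 0)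
    (h₂ : W.twoTorsionCharH1 h.swap₁₂ c = 0) : c = 0 := by
  obtain ⟨φ, rfl⟩ := oneCocycleClass_surjective _ c
  have key : ∀ {a b c : K} (h' : W.toAffine.SplitTwoTorsion a b c),
      W.twoTorsionCharH1 h' (oneCocycleClass _ φ) = 0 → ∀ σ, W.twoTorsionChar h' (φ.1 σ) = 0 := by
    intro a b c h' h0 σ
    rw [twoTorsionCharH1_oneCocycleClass, oneCocycleClass_eq_zero_iff] at h0
    obtain ⟨v, hv⟩ := h0
    have := hv σ
    rw [contOneCocycles.pullback_apply, twoTorsionCharHom_hom_apply] at this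
    change W.twoTorsionChar h' (φ.1 σ) = _ at this
    rw [this]
    change DiscreteGaloisModule.mu K 2 σ v - v = 0
    rw [mu_two_apply_eq, sub_self]
  have hφ : φ = 0 := by
    apply Subtype.ext
    ext σ : 1
    exact W.eq_zero_of_twoTorsionChar_eq_zero h (φ.1 σ) (key h h₁ σ) (key h.swap₁₂ h₂ σ)
  rw [hφ, oneCocycleClass_zero]

end WeierstrassCurve

end
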